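import Literature.NumberTheory.EllipticCurves.PAdicLFunctionMultiplicativeInterpolation
import HarnessLib

/-!
# BSD family — the `p`-adic `L`-function at a prime of NON-SPLIT multiplicative reduction (MTT 1986, §I)

**DEDUP NOTE (2026-08-21, same seat, one hour after landing).** This predicate DUPLICATES existing
tree vocabulary: `IsMultPAdicLFunctionOf f p α L` of
`Literature/NumberTheory/EllipticCurves/PAdicLFunctionMultiplicativeInterpolation.lean` (unit
`b2b-bsdres-x11a` gen 4, 2026-08-18; MTT §I.10/§I.14 with ONE Euler-type factor `(1 - α⁻¹)`,
Greenberg LNM 1716 §4) at `α = -1` is, clause for clause, the statement first landed here (the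
seat's `lean search` missed it). To leave ONE canonical notion in the tree, `IsNonsplitMultPAdicLFunctionOf
f p L` is now the transparent ABBREVIATION `IsMultPAdicLFunctionOf f p (-1) L` (definitionally equal to
the conjunction first landed — `isNonsplitMultPAdicLFunctionOf_iff` is `Iff.rfl` against that spelled-out
conjunction), and CONSUMERS SHOULD USE `IsMultPAdicLFunctionOf f p (-1)` DIRECTLY (as
`PAdicBSDMultiplicativeRankOne.lean`, `Disegni2020/…` do). Nothing else in the tree imports this file.

Leaf companion of `Literature/NumberTheory/EllipticCurves/PAdicBSD.lean` (bsd.S23/S24), written in the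
same vocabulary and normalisations (see that file's module docstring, "Normalisations" table; MTT =
Mazur–Tate–Teitelbaum, Invent. Math. 84 (1986)). That file characterises MTT's `L_p(E, T)` at a *good
ordinary* prime through the prelude's `IsPAdicLFunctionOf f p α L` (`α = unitRoot W p`, constant
term `(1 - α⁻¹)² [0]⁺`) and at a prime of *split* multiplicative reduction through
`IsSplitMultPAdicLFunctionOf f p L` (`α = a_p = 1`, constant term `0`), and records in its design
notes that the multiplicative case needs its own predicate because the prelude's measure
`msdMeasure f α` hard-codes the good-reduction Hecke polynomial `X² - a_p X + p` (trivial
Nebentypus, `ε(p) = 1`). The remaining semistable case — `p ‖ N` with **non-split** multiplicative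
reduction, allowable root `α = a_p = -1` — was not stated there. This file adds exactly that
vocabulary, and nothing else:

* `IsNonsplitMultPAdicLFunctionOf f p L` — the characterisation of MTT's `L_p(E, T)` at a prime
  `p ‖ N` with `a_p = -1` (MTT §I.10 with `ε(p) = 0`: the measure is `μ(a + p^m ℤ_p) = α⁻ᵐ [a/p^m]⁺`,
  `α = a_p = -1`): `L ∈ Λ ⊗ ℚ_p` (`MemIwasawaRat`), `L(0) = (1 - α⁻¹) [0]⁺ = 2 · L(E,1)/Ω⁺_f`
  (ONE Euler-type factor, not the square: Delbourgo 2008, p. 41, last display, "`(1 - 1/a_p(E)) ×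
  L(E,1)/Ω_E^+` if `p` exactly divides `N_E`"), and for `χ` primitive of conductor `p^m`, `m ≥ 1`,
  trivial on `μ(ℤ_p)`, `L(χ(γ_cyc) - 1) = α⁻ᵐ ∑_{a mod p^m} χ(a) [a/p^m]⁺ = (-1)^m τ(χ) L(E, χ̄, 1)/Ω⁺`
  (the `m ≥ 1` clause of the prelude's `IsPAdicLFunctionOf f p α L` at `α = -1`, copied verbatim;
  only the `m = 0` clause differs from the good-reduction package, whose constant term would be
  `(1 - α⁻¹)² [0]⁺ = 4 [0]⁺`);
* two unfolding lemmas (`IsNonsplitMultPAdicLFunctionOf.memIwasawaRat`, `….constantCoeff_eq`: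
  `L(0) = 2 [0]⁺`, so there is no exceptional zero), proved.

What is NOT here: no measure is constructed and no existence/uniqueness of such `L` is asserted
(MTT §I.10–I.14 give both exactly as in the split case, cf. the named fact
`existsUnique_isSplitMultPAdicLFunctionOf` of `PAdicBSD.lean`; a bounded `L` with these
interpolation values is unique by Weierstrass preparation, loc. cit.) — D-0026: no new named fact;
MTT's CONJECTURE BSD(`p`) at a non-split multiplicative prime (§II.10, non-exceptional case,
multiplier `ε_p = 1 - α⁻¹ = 2`) is an open conjecture and therefore NOT stated in Literature: it is
typed over this predicate as the `@[conjecture]` obligation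
`Summit.BirchSwinnertonDyer.Rank1Residual.X11b.PAdicBSDNonsplitMult` in
`Summits/BirchSwinnertonDyer/Rank1Residual/X11b/PAdicBSDNonsplitMult.lean` (human rule 2026-08-15,
"conjectures live in our theories, not literature"; same pattern as `X5/TwoAdicTargets.lean`'s
`TwoAdicBSD` over `PAdicBSDConjecture`); additive reduction is out of scope (Delbourgo 1998/2002,
files `Delbourgo1998/`, `Delbourgo2002/`).

Requested by the bsd-formula-census cell of `b2b-bsdres` (census-lead hand-off H-1, CELL-PLAN §3,
2026-08-21: the non-split multiplicative rank-one relation is typed Summits-side as an instance of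
MTT's BSD(`p`) over this predicate; census output is evidence, never cited here).

## References

* B. Mazur, J. Tate, J. Teitelbaum, *On `p`-adic analogues of the conjectures of Birch and
  Swinnerton-Dyer*, Invent. Math. 84 (1986), §I.10 (the measure `μ_{f,α}` for `p ∣ N`, `ε(p) = 0`,
  allowable root `α = a_p`), §I.12–I.15 (boundedness, interpolation (14.3), `p`-adic multiplier).
* D. Delbourgo, *Elliptic curves and big Galois representations*, LMS Lecture Note Ser. 356 (2008),
  Thm. 2.2 and the displays of p. 41 ("A special case"), Conj. 2.3 (i) (p. 42) [read 2026-08-21].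
* W. Stein, C. Wuthrich, *Algorithms for the arithmetic of elliptic curves using Iwasawa theory*,
  Math. Comp. 82 (2013), §3 (`T`-variable normalisation, `ε_p = 1 - 1/α` at multiplicative `p`).
-/

set_option autoImplicit false

noncomputable section

open scoped Classical MatrixGroups ModularForm

open CongruenceSubgroup WeierstrassCurve Literature.NumberTheory.EllipticCurves.ModularForms

namespace Literature.NumberTheory.EllipticCurves

/-! ### bsd.S23 — `L_p(E, T)` at a prime of non-split multiplicative reduction -/

section NonsplitMultLFunction

variable {N : ℕ}

/-- **bsd.S23** — ALIAS of `IsMultPAdicLFunctionOf f p (-1) L` (see the module docstring's DEDUP NOTE; use that name) — (the `p`-adic `L`-function at a prime of NON-SPLIT multiplicative reduction;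
Mazur–Tate–Teitelbaum 1986, §I.10 (for `p ∣ N` the Hecke polynomial at `p` is `X - a_p`,
`ε(p) = 0`, the allowable root is `α = a_p`, here `a_p = -1`, and the measure is
`μ_{f,α}(a + p^m ℤ_p) = α⁻ᵐ [a/p^m]⁺`), §I.12–I.15; Delbourgo 2008, p. 41).
`IsNonsplitMultPAdicLFunctionOf f p L` says: `L ∈ Λ ⊗ ℚ_p` (`MemIwasawaRat p L`, boundedness — the
measure takes values in `p^{-n} ℤ_p` since `|α|_p = 1`); the constant term is
`L(0) = μ(ℤ_p^×) = μ(ℤ_p) - μ(pℤ_p) = (1 - α⁻¹) [0]⁺_f` with `α = -1`, i.e. `L(0) = 2 · [0]⁺_f =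
2 · L(E, 1)/Ω⁺_f` (`μ(ℤ_p) = α⁻¹ ∑_{a mod p} [a/p]⁺ = α⁻¹ a_p [0]⁺ = [0]⁺` by `U_p f = a_p f`;
Delbourgo 2008, p. 41: "`𝐋_p(E,1) = (1 - 1/a_p(E)) × L(E,1)/Ω_E^+` if `p` exactly divides `N_E`" —
ONE factor `1 - α⁻¹`, where the good-reduction package `IsPAdicLFunctionOf` has its square); and for
every `m ≥ 1` and every primitive Dirichlet character `χ` of conductor `p^m` with values in `ℂ_p`
which is a character of `Γ` (even, of `p`-power order), `L(χ(γ_cyc) - 1) = ∑_k c_k (χ(γ_cyc) - 1)^k`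
converges to `α⁻ᵐ ∑_{a mod p^m} χ(a) [a/p^m]⁺_f` (`= (-1)^m τ(χ) L(E, χ̄, 1)/Ω⁺_f` by Birch's
formula, `ratTwistedSymbolSum_mul_plusPeriod`), `γ_cyc = cyclotomicGenerator p` — this second clause
is, word for word, the `m ≥ 1` clause of the prelude's `IsPAdicLFunctionOf f p α L` at `α = -1`
(MTT (14.3) with `ε(p) = 0`: the second term of the good-reduction measure integrates to `0` against
a primitive `χ` anyway). As for `IsSplitMultPAdicLFunctionOf`, the prelude's `padicLFunction f α` is
*not* this function (its measure presumes good reduction), so statements quantify over `L` with this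
property; a bounded such `L` is unique (Weierstrass preparation, as in
`existsUnique_isSplitMultPAdicLFunctionOf`), existence is MTT §I.10–I.14 — neither is asserted here.
[cite: MazurTateTeitelbaum1986Invent, §I.10, §I.14 (14.3), §I.15] -/
abbrev IsNonsplitMultPAdicLFunctionOf (f : CuspForm (Gamma0 N) 2) (p : ℕ) [Fact p.Prime]
    (L : PowerSeries ℚ_[p]) : Prop :=
  IsMultPAdicLFunctionOf f p (-1) L

variable {f : CuspForm (Gamma0 N) 2} {p : ℕ} [Fact p.Prime] {L : PowerSeries ℚ_[p]}

/-- `IsNonsplitMultPAdicLFunctionOf f p L` unfolds to the conjunction originally landed in this file: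
boundedness, constant term `(1 - (-1)⁻¹)·[0]⁺_f`, and the twisted interpolation clause with `α = -1`
— i.e. it IS `IsMultPAdicLFunctionOf f p (-1) L` (Mazur–Tate–Teitelbaum 1986 §I.10/§I.14; dedup
bridge, by `Iff.rfl`). [cite: MazurTateTeitelbaum1986Invent, §I.10, §I.14 (14.3)] -/
theorem isNonsplitMultPAdicLFunctionOf_iff :
    IsNonsplitMultPAdicLFunctionOf f p L ↔
      (MemIwasawaRat p L ∧
        PowerSeries.constantCoeff L = (1 - (-1 : ℚ_[p])⁻¹) * (ratPlusSymbol f 0 : ℚ_[p]) ∧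
        ∀ (m : ℕ), 0 < m → ∀ χ : DirichletCharacter ℂ_[p] (p ^ m), χ.IsPrimitive → χ.Even →
          (∃ j : ℕ, orderOf χ = p ^ j) →
            HasSum (fun k : ℕ ↦ algebraMap ℚ_[p] ℂ_[p] (PowerSeries.coeff k L) *
                (χ (cyclotomicGenerator p : ZMod (p ^ m)) - 1) ^ k)
              (algebraMap ℚ_[p] ℂ_[p] ((-1 : ℚ_[p])⁻¹ ^ m) * ratTwistedSymbolSum f χ)) :=
  Iff.rfl

/-- An `L` with `IsNonsplitMultPAdicLFunctionOf f p L` lies in `Λ ⊗ ℚ_p = Λ[1/p]` (first clause;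
Mazur–Tate–Teitelbaum 1986, §I.12: the measure of a `p`-adic unit root is bounded).
[cite: MazurTateTeitelbaum1986Invent, §I.12] -/
theorem IsNonsplitMultPAdicLFunctionOf.memIwasawaRat (hL : IsNonsplitMultPAdicLFunctionOf f p L) :
    MemIwasawaRat p L :=
  hL.1

/-- The constant term of a non-split multiplicative `p`-adic `L`-function is `2 · [0]⁺_f`
(`= (1 - α⁻¹) [0]⁺_f` at `α = a_p = -1`; Delbourgo 2008, p. 41: `𝐋_p(E,1) = (1 - 1/a_p(E)) L(E,1)/Ω_E^+`
for `p ‖ N_E`). In particular there is no exceptional zero: `L(0) = 0 ↔ L(E, 1) = 0`.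
[cite: Delbourgo2008, p. 41 (display "A special case") and Conj. 2.3 (i), p. 42] -/
theorem IsNonsplitMultPAdicLFunctionOf.constantCoeff_eq (hL : IsNonsplitMultPAdicLFunctionOf f p L) :
    PowerSeries.constantCoeff L = 2 * (ratPlusSymbol f 0 : ℚ_[p]) := by
  rw [hL.2.1]
  norm_num

end NonsplitMultLFunction

end Literature.NumberTheory.EllipticCurves

end
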